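import Summits.BirchSwinnertonDyer.BirchSwinnertonDyer.Theorems.AdditiveBranchIMCGordTwoRankOneHeegnerKolyvaginManinIstar
import Summits.BirchSwinnertonDyer.BirchSwinnertonDyer.Theorems.AdditiveBranchIMCGordTwoRankOneHeegnerKolyvaginBSDp
import HarnessLib

/-!
# Route `AdditiveBranchIMC` (rung K1), crux `GordTwoRankOne` (item 19358): the Heegner–Kolyvagin road,
# Part 19 — Part 11's class-level `BSD(E,p)` from `p ≥ 11` down to `p ≥ 5`, and ENGINE-FREE per-pair doors of
# JSW shape on the surjective rows: `BSD(E,p)` from PUBLISHED facts + the unit datum of `E` + ONE Heegner twist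
# (cell `bsd-addord`, second prover lane `bsd-addord-k1-c3x`, gen 4; `--supports` only)

HONEST FRAMING. THEOREMS ONLY: no definition, no new named fact, no `sorry`; nothing is booked here; crux
19358 stays OPEN at class level; BSD is not proved by any of this. The per-pair data (`hq hv`, `hqd hvd`) are
the admitted EXACT-`#Ш_an` currency of the books (lane A gen 5, b2b `Typed.bsdp_of_card_selmerGroup_eq_pow_analyticRank`):
hypotheses discharged per pair by a table value, never asserted here.

WHY (the director's «JSW17 shape for the whole rank-one branch instead of tranche-by-tranche certificates»).
On lane B's road `BSD(E,p)` on a surjective row of cell (G-ord, `e = 2`) ∩ `r_an = 1` at `p ≥ 5`, `p ∤ ∏c_ℓ(E)`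
splits as (Parts 6, 8, 9, 11, 18): LOWER(E) ⟸ STEP L′ [open]; UPPER(E) ⟸ Kolyvagin 1990 Thm. A at a Manin-good
odd frame + Gross–Zagier + the rank-ZERO LOWER half of the Heegner twist `E^{d_K}` [crux 19357 there, open].
Both open inputs are FREE on their unit windows: LOWER(E) when `ord_p #Ш(E)_an ≤ 0`
(`N10.missingLowerBoundAt_of_padicValRat_le_zero`), LOWER(E^{d_K}) when `ord_p #Ш(E^{d_K})_an ≤ 0`. And by
Part 18a the Manin-good datum at ANY Heegner field is PUBLISHED at every odd `p` (Mazur–Stevens on `I₀*`). HENCE,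
per pair, with NO engine, NO `p`-adic `L`-function, NO `p`-adic height, NO Schneider certificate, NO reading
(after §32 = Part 11's CLASS-LEVEL `BSD(E,p)` on the surjective rows — STEP L′ / item 20498 / the crux as the LOWER input +
the rank-zero LOWER half at the Heegner twists + PUB — extended from `p ≥ 11` to `p ≥ 5` by Part 18a's datum):
* §34 `missingUpperBoundAt_rankOne_cellGordTwo_of_twistShaAnUnit` — UPPER(E) at `(E,p)` from PUB + ONE Heegner
  field `K` of the conductor with `L(E^{d_K},1) ≠ 0` and `ord_p #Ш(E^{d_K})_an ≤ 0` (a globally minimal `Wd`);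
* §34 `bsdp_rankOne_cellGordTwo_of_shaAnUnit_of_twistShaAnUnit` — `BSDp W p` from PUB + `ord_p #Ш(E)_an ≤ 0`
  + the same twist datum;
* §34 `bsdp_rankOne_cellGordTwo_of_shaAnUnit_of_twistLower` — `BSDp W p` from PUB + `ord_p #Ш(E)_an ≤ 0` +
  crux 19357's conclusion `Typed.MissingLowerBoundAt Wd p` at the twist (content twists).
PUBLISHED binders: `hGZ` (Gross–Zagier), `hKo` (Kolyvagin, qualitative), `hB` (Kolyvagin 1990 Thm. A), `hGZK`,
`hmod`, `hnf` (modularity), cite-only `hMz hAU hC2` (Mazur 1978 Cor. 4.1, Abbes–Ullmo 1996 Thm. A, Česnavičius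
2018 Thm. 1.2 — Part 18a's Manin datum). Row: `r_an = 1`, `N10.CellGordTwo W p`, `5 ≤ p`, `ρ̄_{E,p}` onto,
`p ∤ ∏c_ℓ(E)`. WHAT THIS IS NOT: not a class-level statement; the twist `E^{d_K}` has conductor `N·d_K²`, so
its `#Ш_an` is a computed value, not always a table entry; nothing is booked by this file.

References: [JetchevSkinnerWan2017] §7.4.1–7.4.3; [KolyvaginEulerSystems1990] Thm. A; [McCallumLMS1991] §1;
[GrossZagier1986] V.§2; [EdixhovenManin1991] §1; [Stevens1989] (5.2), (5.4); [Mazur1978] Cor. 4.1;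
[AbbesUllmo1996] Thm. A; [Cesnavicius2018] Thm. 1.2; [Darmon2004] Thm. 3.6; [Miller2011LMS] Def. 1.1.
-/

set_option autoImplicit false
set_option linter.dupNamespace false
noncomputable section
open scoped Classical NumberField
open WeierstrassCurve NumberField IsDedekindDomain Literature.NumberTheory.EllipticCurves
  Literature.NumberTheory.EllipticCurves.ModularForms Literature.NumberTheory.EllipticCurves.Rank1Residual
  Literature.NumberTheory.EllipticCurves.Rank1Residual.Typed Literature.NumberTheory.Automorphic
  Summit.BirchSwinnertonDyer.Rank1Residual Summit.BirchSwinnertonDyer.Rank1Residual.Additive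
  Summit.BirchSwinnertonDyer.Rank1Residual.X11b Summit.BirchSwinnertonDyer.Rank1Residual.GaloisImage

namespace Summit.BirchSwinnertonDyer.BirchSwinnertonDyer.Theorems.AdditiveBranchIMCGordTwoRankOne.HeegnerKolyvagin

/-! ### §32 Part 11's class-level `BSD(E,p)` on the surjective rows, from `p ≥ 11` down to `p ≥ 5` -/

/-- **`BSD(E,p)` (both halves), CLASS LEVEL, on the surjective rows of cell (G-ord, `e = 2`) ∩ `r_an = 1` at
`p ≥ 5`, `p ∤ ∏c_ℓ(E)`** — Part 11's `cellGordTwo_bsdp_rankOne_of_surj_of_adjustedIndexBound_of_twistLower`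
with the Manin-good datum from Part 18a §30 (cite-only `hMz hAU hC2`) instead of Edixhoven 1991 Thm. 3 (`hmodP hEdxK
hNS`, `p ≥ 11`). PUBLISHED binders `hGZ hKo hB hKatoT hGZK hmod hnf hFH hMz hAU hC2`; TWO TYPED OPEN INPUTS as
there: `hL'` = STEP L′ at the Heegner data of the tower-surjective rank-one rows (item 20498), `hTwL` = the
rank-ZERO LOWER half at every globally minimal model of a Heegner-field twist with `L(E^{d_K},1) ≠ 0` (crux
19357's conclusion there). LOWER by Part 8, UPPER by Part 6, glued by x11b's `bsdp_of_halves`. Nothing booked.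
[cite: JetchevSkinnerWan2017, §7.4.1–§7.4.3 (pp. 29–31)] [cite: McCallumLMS1991, §1 Theorem (Kolyvagin), p. 296]
[cite: EdixhovenManin1991, §1] [cite: Mazur1978, Cor. 4.1] [cite: AbbesUllmo1996, Thm. A]
[cite: SerreAbelianLadic1968, Ch. IV §3.4, Lemma 3 (IV-23)] [cite: Miller2011LMS, §1 and Def. 1.1] -/
theorem cellGordTwo_bsdp_rankOne_of_surj_five_of_adjustedIndexBound_of_twistLower
    (hGZ : ∀ (N : ℕ) [NeZero N] (W : WeierstrassCurve ℚ) (K : Type) [Field K] [NumberField K],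
      gross_zagier N W K)
    (hKo : ∀ (N : ℕ) [NeZero N] (W : WeierstrassCurve ℚ) (K : Type) [Field K] [NumberField K],
      kolyvagin N W K)
    (hB : ∀ (N : ℕ) [NeZero N] (W : WeierstrassCurve ℚ) (K : Type) [Field K] [NumberField K],
      Kolyvagin1990_padicValNat_card_sha_le N W K)
    (hKatoT : Kato2004.rankZero_padicValNat_sha_add_padicValNat_tamagawa_le_of_additive_potGood_of_imageContainsSL2)
    (hGZK : rank_eq_analyticRank_of_analyticRank_le_one) (hmod : hasEntireLFunction_rat)
    (hnf : exists_isNewformOf)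
    (hFH : friedbergHoffstein_exists_heegnerField_split_twist_ne_zero)
    (hMz : mazur_not_dvd_maninConstant_of_odd)
    (hAU : abbesUllmo_not_dvd_maninConstant_of_not_dvd_level)
    (hC2 : cesnavicius_not_two_dvd_maninConstant_of_two_dvd_level)
    (hL' : ∀ (W : WeierstrassCurve ℚ) [W.IsElliptic] [W.IsGloballyMinimal] (p : ℕ) [Fact p.Prime]
      (N : ℕ) [NeZero N] (K : Type) [Field K] [NumberField K]
      (Dt : ModularParametrizationData W N) (H : HeegnerDatum N (NumberField.discr K)) (ι : K →+* ℂ)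
      (P : (W.baseChange K).toAffine.Point)
      (Wd : WeierstrassCurve ℚ) [Wd.IsElliptic] [Wd.IsGloballyMinimal] (Cd : VariableChange ℚ),
      W.analyticRank = 1 → N10.CellGordTwo W p → (∀ n : ℕ, W.HasSurjectiveModNGaloisRep (p ^ n : ℕ)) →
      W.conductorNorm ℤ = N → IsImaginaryQuadratic K → SatisfiesHeegnerHypothesis N K →
      WeierstrassCurve.Affine.Point.map ι.toRatAlgHom P = heegnerPointComplex Dt H →
      Cd • W.quadraticTwist (NumberField.discr K : ℚ) = Wd →
      Finite (W.baseChange K).sha →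
      (2 * padicValNat p (AddSubgroup.zmultiples P).index : ℤ) ≤
        padicValNat p (W.baseChange K).shaOrder + padicValNat p W.tamagawaProduct +
          padicValNat p Wd.tamagawaProduct + 2 * padicValRat p (Dt.c : ℚ))
    (hTwL : ∀ (W : WeierstrassCurve ℚ) [W.IsElliptic] [W.IsGloballyMinimal] (p : ℕ) [Fact p.Prime]
      (K : Type) [Field K] [NumberField K]
      (Wd : WeierstrassCurve ℚ) [Wd.IsElliptic] [Wd.IsGloballyMinimal] (Cd : VariableChange ℚ),
      W.analyticRank = 1 → N10.CellGordTwo W p → (∀ n : ℕ, W.HasSurjectiveModNGaloisRep (p ^ n : ℕ)) →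
      IsImaginaryQuadratic K → SatisfiesHeegnerHypothesis (W.conductorNorm ℤ) K →
      (W.quadraticTwist (NumberField.discr K : ℚ)).entireLFunction 1 ≠ 0 →
      Cd • W.quadraticTwist (NumberField.discr K : ℚ) = Wd → Typed.MissingLowerBoundAt Wd p) :
    ∀ (W : WeierstrassCurve ℚ) [W.IsElliptic] [W.IsGloballyMinimal] (p : ℕ) [Fact p.Prime],
      W.analyticRank = 1 → N10.CellGordTwo W p → 5 ≤ p → W.HasSurjectiveModNGaloisRep p →
      ¬ p ∣ W.tamagawaProduct → BSDp W p := by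
  intro W _ _ p _ hr hc2 hp5 hsurj1 htam0
  have hp : p.Prime := Fact.out
  have hsurj : ∀ n : ℕ, W.HasSurjectiveModNGaloisRep (p ^ n : ℕ) :=
    serre_hasSurjectiveModNGaloisRep_pow_holds W p hp5 hsurj1
  obtain ⟨hp2, hadd, hG, he⟩ := hc2
  haveI : NeZero (W.conductorNorm ℤ) := ⟨(W.conductorNorm_pos_holds).ne'⟩
  have hj : 0 ≤ padicValRat p W.j := not_lt.mp (N10.not_potMult_of_typeGOrd W p hp2 hadd hG)
  have hirr : W.HasIrreducibleModPGaloisRep p :=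
    hasIrreducibleModPGaloisRep_of_hasSurjectiveModNGaloisRep W p hsurj1
  have hw : W.rootNumber = -1 := by
    rw [WeierstrassCurve.rootNumber_eq_neg_one_pow_analyticRank_of_exists_isNewformOf hnf W, hr]
    norm_num
  -- Friedberg–Hoffstein field: every `ℓ ∣ N` split, `|d_K| > 4`, `L(E^{d_K},1) ≠ 0`
  obtain ⟨K, _, _, hK, hdisc, hHN, -, hLt⟩ := hFH W hw p hp 4
  have hμ : ¬ p ∣ Units.torsionOrder K := by
    haveI : IsTotallyComplex K := hK.2
    have hneg : NumberField.discr K < 0 := discr_neg_of_finrank_eq_two K hK.1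
    have habs : ((NumberField.discr K).natAbs : ℤ) = -NumberField.discr K := Int.ofNat_natAbs_of_nonpos hneg.le
    have h4 : NumberField.discr K < -4 := by
      have : (4 : ℤ) < ((NumberField.discr K).natAbs : ℤ) := by exact_mod_cast hdisc
      omega
    rw [Literature.NumberTheory.DiophantineGeometry.torsionOrder_eq_two_of_discr_lt hK.1 h4]
    intro h2
    have := Nat.le_of_dvd two_pos h2; have h2le : 2 ≤ p := hp.two_le; omega
  -- the Manin-good Heegner datum (Mazur–Stevens on `I₀*`, Part 18a §30: every odd `p`)
  obtain ⟨Dt, H, ι, P, hP, hc⟩ :=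
    exists_maninDatum_of_cellGordTwo_of_irr hnf hMz hAU hC2 W p K ⟨hp2, hadd, hG, he⟩ hirr hK hHN
  have hD0 : (NumberField.discr K : ℚ) ≠ 0 := by exact_mod_cast NumberField.discr_ne_zero K
  haveI hEt : (W.quadraticTwist (NumberField.discr K : ℚ)).IsElliptic := W.isElliptic_quadraticTwist hD0
  obtain ⟨Cd, hCd⟩ := hasGlobalMinimalModel_rat_holds (W.quadraticTwist (NumberField.discr K : ℚ))
  haveI : (Cd • W.quadraticTwist (NumberField.discr K : ℚ)).IsGloballyMinimal := hCd
  have hWd : Cd • W.quadraticTwist (NumberField.discr K : ℚ) = Cd • W.quadraticTwist (discr K : ℚ) := rfl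
  have htwL : Typed.MissingLowerBoundAt (Cd • W.quadraticTwist (NumberField.discr K : ℚ)) p :=
    hTwL W p K (Cd • W.quadraticTwist (NumberField.discr K : ℚ)) Cd hr ⟨hp2, hadd, hG, he⟩ hsurj hK hHN
      hLt hWd
  exact bsdp_of_halves hGZK W p (le_of_eq hr)
    (missingLowerBoundAt_rankOne_additive_of_adjustedIndexBound W p K Dt H ι P (hGZ _ W K) (hKo _ W K)
      hKatoT hGZK hmod hr hp2 hadd hj hsurj hK hHN hP hμ hLt
      (Cd • W.quadraticTwist (NumberField.discr K : ℚ)) Cd hWd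
      (hL' W p _ K Dt H ι P (Cd • W.quadraticTwist (NumberField.discr K : ℚ)) Cd hr ⟨hp2, hadd, hG, he⟩
        hsurj rfl hK hHN hP hWd))
    (missingUpperBoundAt_rankOne_additive_of_twistLower W p K Dt H ι P (hGZ _ W K) (hKo _ W K) (hB _ W K)
      hGZK hmod hr hp5 hsurj1 htam0 hK hHN hP hc hμ hLt
      (Cd • W.quadraticTwist (NumberField.discr K : ℚ)) Cd hWd hadd.1 htwL)

/-- **The same with STEP L′ read off ITEM 20498 BY NAME** (`AdjustedHeegnerIndexBoundTowerSurj`, the route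
decl, as the hypothesis `hL'`): Part 13's `cellGordTwo_bsdp_rankOne_of_surj_of_item_of_twistLower` from `p ≥ 11`
down to `p ≥ 5`. `BSDp W p ⟸ 20498 ∧ 19357(twists) ∧ PUB` on the surjective rows with `p ∤ ∏c_ℓ(E)`. Nothing
booked; both inputs OPEN. [cite: JetchevSkinnerWan2017, §7.4.1–§7.4.3 (pp. 29–31)]
[cite: McCallumLMS1991, §1 Theorem (Kolyvagin), p. 296] [cite: EdixhovenManin1991, §1] [cite: Miller2011LMS, Def. 1.1] -/
theorem cellGordTwo_bsdp_rankOne_of_surj_five_of_item_of_twistLower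
    (hGZ : ∀ (N : ℕ) [NeZero N] (W : WeierstrassCurve ℚ) (K : Type) [Field K] [NumberField K],
      gross_zagier N W K)
    (hKo : ∀ (N : ℕ) [NeZero N] (W : WeierstrassCurve ℚ) (K : Type) [Field K] [NumberField K],
      kolyvagin N W K)
    (hB : ∀ (N : ℕ) [NeZero N] (W : WeierstrassCurve ℚ) (K : Type) [Field K] [NumberField K],
      Kolyvagin1990_padicValNat_card_sha_le N W K)
    (hKatoT : Kato2004.rankZero_padicValNat_sha_add_padicValNat_tamagawa_le_of_additive_potGood_of_imageContainsSL2)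
    (hGZK : rank_eq_analyticRank_of_analyticRank_le_one) (hmod : hasEntireLFunction_rat)
    (hnf : exists_isNewformOf)
    (hFH : friedbergHoffstein_exists_heegnerField_split_twist_ne_zero)
    (hMz : mazur_not_dvd_maninConstant_of_odd)
    (hAU : abbesUllmo_not_dvd_maninConstant_of_not_dvd_level)
    (hC2 : cesnavicius_not_two_dvd_maninConstant_of_two_dvd_level)
    (hL' : Summit.BirchSwinnertonDyer.BirchSwinnertonDyer.Theses.AdditiveBranchIMC.AdjustedHeegnerIndexBoundTowerSurj)
    (hTwL : ∀ (W : WeierstrassCurve ℚ) [W.IsElliptic] [W.IsGloballyMinimal] (p : ℕ) [Fact p.Prime]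
      (K : Type) [Field K] [NumberField K]
      (Wd : WeierstrassCurve ℚ) [Wd.IsElliptic] [Wd.IsGloballyMinimal] (Cd : VariableChange ℚ),
      W.analyticRank = 1 → N10.CellGordTwo W p → (∀ n : ℕ, W.HasSurjectiveModNGaloisRep (p ^ n : ℕ)) →
      IsImaginaryQuadratic K → SatisfiesHeegnerHypothesis (W.conductorNorm ℤ) K →
      (W.quadraticTwist (NumberField.discr K : ℚ)).entireLFunction 1 ≠ 0 →
      Cd • W.quadraticTwist (NumberField.discr K : ℚ) = Wd → Typed.MissingLowerBoundAt Wd p) :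
    ∀ (W : WeierstrassCurve ℚ) [W.IsElliptic] [W.IsGloballyMinimal] (p : ℕ) [Fact p.Prime],
      W.analyticRank = 1 → N10.CellGordTwo W p → 5 ≤ p → W.HasSurjectiveModNGaloisRep p →
      ¬ p ∣ W.tamagawaProduct → BSDp W p :=
  cellGordTwo_bsdp_rankOne_of_surj_five_of_adjustedIndexBound_of_twistLower hGZ hKo hB hKatoT hGZK hmod hnf hFH
    hMz hAU hC2 (fun W _ _ p _ N _ K _ _ Dt H ι P Wd _ _ Cd ↦ hL' W p N K Dt H ι P Wd Cd) hTwL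

/-- **The same with the crux BY NAME as the LOWER input, at `p ≥ 5`** (Part 11's
`cellGordTwo_bsdp_rankOne_of_surj_of_gordTwoRankOne_of_twistLower` had `p ≥ 11`): `GordTwoRankOne` (item 19358,
a HYPOTHESIS) + the rank-zero LOWER half at the Heegner-field twists (`hTwL`) + PUB (incl. cite-only
`hMz hAU hC2`) ⟹ `BSDp W p` on every rank-one pair of the cell with `p ≥ 5`, `ρ̄_{E,p}` onto, `p ∤ ∏c_ℓ(E)`.
Nothing booked. [cite: JetchevSkinnerWan2017, §7.4.2–§7.4.3 (p. 31)] [cite: McCallumLMS1991, §1 (p. 296)]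
[cite: EdixhovenManin1991, §1] [cite: Mazur1978, Cor. 4.1] [cite: Miller2011LMS, §1 and Def. 1.1] -/
theorem cellGordTwo_bsdp_rankOne_of_surj_five_of_gordTwoRankOne_of_twistLower
    (hcrux : Summit.BirchSwinnertonDyer.BirchSwinnertonDyer.Theses.AdditiveBranchIMC.GordTwoRankOne)
    (hGZ : ∀ (N : ℕ) [NeZero N] (W : WeierstrassCurve ℚ) (K : Type) [Field K] [NumberField K],
      gross_zagier N W K)
    (hKo : ∀ (N : ℕ) [NeZero N] (W : WeierstrassCurve ℚ) (K : Type) [Field K] [NumberField K],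
      kolyvagin N W K)
    (hB : ∀ (N : ℕ) [NeZero N] (W : WeierstrassCurve ℚ) (K : Type) [Field K] [NumberField K],
      Kolyvagin1990_padicValNat_card_sha_le N W K)
    (hGZK : rank_eq_analyticRank_of_analyticRank_le_one) (hmod : hasEntireLFunction_rat)
    (hnf : exists_isNewformOf)
    (hFH : friedbergHoffstein_exists_heegnerField_split_twist_ne_zero)
    (hMz : mazur_not_dvd_maninConstant_of_odd)
    (hAU : abbesUllmo_not_dvd_maninConstant_of_not_dvd_level)
    (hC2 : cesnavicius_not_two_dvd_maninConstant_of_two_dvd_level)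
    (hTwL : ∀ (W : WeierstrassCurve ℚ) [W.IsElliptic] [W.IsGloballyMinimal] (p : ℕ) [Fact p.Prime]
      (K : Type) [Field K] [NumberField K]
      (Wd : WeierstrassCurve ℚ) [Wd.IsElliptic] [Wd.IsGloballyMinimal] (Cd : VariableChange ℚ),
      W.analyticRank = 1 → N10.CellGordTwo W p → (∀ n : ℕ, W.HasSurjectiveModNGaloisRep (p ^ n : ℕ)) →
      IsImaginaryQuadratic K → SatisfiesHeegnerHypothesis (W.conductorNorm ℤ) K →
      (W.quadraticTwist (NumberField.discr K : ℚ)).entireLFunction 1 ≠ 0 →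
      Cd • W.quadraticTwist (NumberField.discr K : ℚ) = Wd → Typed.MissingLowerBoundAt Wd p) :
    ∀ (W : WeierstrassCurve ℚ) [W.IsElliptic] [W.IsGloballyMinimal] (p : ℕ) [Fact p.Prime],
      W.analyticRank = 1 → N10.CellGordTwo W p → 5 ≤ p → W.HasSurjectiveModNGaloisRep p →
      ¬ p ∣ W.tamagawaProduct → BSDp W p := by
  intro W _ _ p _ hr hc2 hp5 hsurj1 htam0
  have hp : p.Prime := Fact.out
  have hsurj : ∀ n : ℕ, W.HasSurjectiveModNGaloisRep (p ^ n : ℕ) :=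
    serre_hasSurjectiveModNGaloisRep_pow_holds W p hp5 hsurj1
  have hlow : Typed.MissingLowerBoundAt W p := hcrux W p hr hc2
  obtain ⟨hp2, hadd, hG, he⟩ := hc2
  haveI : NeZero (W.conductorNorm ℤ) := ⟨(W.conductorNorm_pos_holds).ne'⟩
  have hirr : W.HasIrreducibleModPGaloisRep p :=
    hasIrreducibleModPGaloisRep_of_hasSurjectiveModNGaloisRep W p hsurj1
  have hw : W.rootNumber = -1 := by
    rw [WeierstrassCurve.rootNumber_eq_neg_one_pow_analyticRank_of_exists_isNewformOf hnf W, hr]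
    norm_num
  obtain ⟨K, _, _, hK, hdisc, hHN, -, hLt⟩ := hFH W hw p hp 4
  have hμ : ¬ p ∣ Units.torsionOrder K := by
    haveI : IsTotallyComplex K := hK.2
    have hneg : NumberField.discr K < 0 := discr_neg_of_finrank_eq_two K hK.1
    have habs : ((NumberField.discr K).natAbs : ℤ) = -NumberField.discr K := Int.ofNat_natAbs_of_nonpos hneg.le
    have h4 : NumberField.discr K < -4 := by
      have : (4 : ℤ) < ((NumberField.discr K).natAbs : ℤ) := by exact_mod_cast hdisc
      omega
    rw [Literature.NumberTheory.DiophantineGeometry.torsionOrder_eq_two_of_discr_lt hK.1 h4]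
    intro h2
    have := Nat.le_of_dvd two_pos h2; have h2le : 2 ≤ p := hp.two_le; omega
  obtain ⟨Dt, H, ι, P, hP, hc⟩ :=
    exists_maninDatum_of_cellGordTwo_of_irr hnf hMz hAU hC2 W p K ⟨hp2, hadd, hG, he⟩ hirr hK hHN
  have hD0 : (NumberField.discr K : ℚ) ≠ 0 := by exact_mod_cast NumberField.discr_ne_zero K
  haveI hEt : (W.quadraticTwist (NumberField.discr K : ℚ)).IsElliptic := W.isElliptic_quadraticTwist hD0
  obtain ⟨Cd, hCd⟩ := hasGlobalMinimalModel_rat_holds (W.quadraticTwist (NumberField.discr K : ℚ))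
  haveI : (Cd • W.quadraticTwist (NumberField.discr K : ℚ)).IsGloballyMinimal := hCd
  have hWd : Cd • W.quadraticTwist (NumberField.discr K : ℚ) = Cd • W.quadraticTwist (discr K : ℚ) := rfl
  have htwL : Typed.MissingLowerBoundAt (Cd • W.quadraticTwist (NumberField.discr K : ℚ)) p :=
    hTwL W p K (Cd • W.quadraticTwist (NumberField.discr K : ℚ)) Cd hr ⟨hp2, hadd, hG, he⟩ hsurj hK hHN
      hLt hWd
  exact bsdp_of_halves hGZK W p (le_of_eq hr) hlow
    (missingUpperBoundAt_rankOne_additive_of_twistLower W p K Dt H ι P (hGZ _ W K) (hKo _ W K) (hB _ W K)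
      hGZK hmod hr hp5 hsurj1 htam0 hK hHN hP hc hμ hLt
      (Cd • W.quadraticTwist (NumberField.discr K : ℚ)) Cd hWd hadd.1 htwL)

/-! ### §34 Engine-free per-pair doors: UPPER(E) and `BSD(E,p)` from PUB + unit data (E and one twist) -/

/-- **UPPER(E,p) per pair from PUBLISHED facts + the unit value datum of ONE Heegner twist.** Row: `W/ℚ`
globally minimal, `r_an = 1`, `N10.CellGordTwo W p`, `p ≥ 5`, `ρ̄_{E,p}` onto, `p ∤ ∏c_ℓ(E)`. Datum: an imaginary
quadratic `K`, Heegner for `N(W)`, with `L(E^{d_K},1) ≠ 0`, a globally minimal model `Wd = Cd • E^{d_K}`, and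
`#Ш(Wd)_an = qd ∈ ℚ` with `ord_p qd ≤ 0` (then LOWER(Wd) is free). PUB: `hGZ hKo hB hGZK hmod hnf` + cite-only
`hMz hAU hC2` (the Manin-good datum at `K`, Part 18a). Conclusion: `Typed.MissingUpperBoundAt W p`
(`ord_p #Ш(E) ≤ ord_p #Ш(E)_an`) by Part 6 `missingUpperBoundAt_rankOne_additive_of_twistLower`; `p ∤ #𝓞_K^×`
is automatic (Part 12). No engine, no reading. [cite: JetchevSkinnerWan2017, §7.4.2 (eq:shaupper), p. 31]
[cite: McCallumLMS1991, §1 Theorem (Kolyvagin), p. 296] [cite: EdixhovenManin1991, §1] [cite: Mazur1978, Cor. 4.1]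
[cite: AbbesUllmo1996, Thm. A] [cite: Darmon2004, Thm. 3.6] [cite: Miller2011LMS, Def. 1.1] -/
theorem missingUpperBoundAt_rankOne_cellGordTwo_of_twistShaAnUnit
    (hGZ : ∀ (N : ℕ) [NeZero N] (W : WeierstrassCurve ℚ) (K : Type) [Field K] [NumberField K],
      gross_zagier N W K)
    (hKo : ∀ (N : ℕ) [NeZero N] (W : WeierstrassCurve ℚ) (K : Type) [Field K] [NumberField K],
      kolyvagin N W K)
    (hB : ∀ (N : ℕ) [NeZero N] (W : WeierstrassCurve ℚ) (K : Type) [Field K] [NumberField K],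
      Kolyvagin1990_padicValNat_card_sha_le N W K)
    (hGZK : rank_eq_analyticRank_of_analyticRank_le_one) (hmod : hasEntireLFunction_rat)
    (hnf : exists_isNewformOf)
    (hMz : mazur_not_dvd_maninConstant_of_odd)
    (hAU : abbesUllmo_not_dvd_maninConstant_of_not_dvd_level)
    (hC2 : cesnavicius_not_two_dvd_maninConstant_of_two_dvd_level)
    (W : WeierstrassCurve ℚ) [W.IsElliptic] [W.IsGloballyMinimal] (p : ℕ) [Fact p.Prime]
    (K : Type) [Field K] [NumberField K]
    (Wd : WeierstrassCurve ℚ) [Wd.IsElliptic] [Wd.IsGloballyMinimal] (Cd : VariableChange ℚ)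
    (hr : W.analyticRank = 1) (hc2 : N10.CellGordTwo W p) (hp5 : 5 ≤ p)
    (hsurj : W.HasSurjectiveModNGaloisRep p) (htam : ¬ p ∣ W.tamagawaProduct)
    (hK : IsImaginaryQuadratic K) (hHN : SatisfiesHeegnerHypothesis (W.conductorNorm ℤ) K)
    (hLt : (W.quadraticTwist (NumberField.discr K : ℚ)).entireLFunction 1 ≠ 0)
    (hWd : Cd • W.quadraticTwist (NumberField.discr K : ℚ) = Wd)
    {qd : ℚ} (hqd : shaAn Wd = (qd : ℂ)) (hvd : padicValRat p qd ≤ 0) :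
    Typed.MissingUpperBoundAt W p := by
  have hp : p.Prime := Fact.out
  have hp2 : p ≠ 2 := hc2.1
  have hadd : Addv W p := hc2.2.1
  haveI : NeZero (W.conductorNorm ℤ) := ⟨(W.conductorNorm_pos_holds).ne'⟩
  have hirr : Irr W p := hasIrreducibleModPGaloisRep_of_hasSurjectiveModNGaloisRep W p hsurj
  have hpN : p ∣ W.conductorNorm ℤ := (W.dvd_conductorNorm_iff_not_hasGoodReductionAtPrime p).mpr hadd.1
  have hμ : ¬ p ∣ Units.torsionOrder K := not_dvd_unitsTorsionOrder_of_heegner hK hHN hp hp2 hpN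
  -- the Manin-good Heegner datum at `K` (Mazur–Stevens on `I₀*`, Part 18a)
  obtain ⟨Dt, H, ι, P, hP, hc⟩ := exists_maninDatum_of_cellGordTwo_of_irr hnf hMz hAU hC2 W p K hc2 hirr hK hHN
  -- the twist's LOWER half is free on its unit window
  have htwL : Typed.MissingLowerBoundAt Wd p := N10.missingLowerBoundAt_of_padicValRat_le_zero Wd p hqd hvd
  exact missingUpperBoundAt_rankOne_additive_of_twistLower W p K Dt H ι P (hGZ _ W K) (hKo _ W K) (hB _ W K)
    hGZK hmod hr hp5 hsurj htam hK hHN hP hc hμ hLt Wd Cd hWd hadd.1 htwL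

/-- **`BSD(E,p)` per pair from PUBLISHED facts + TWO unit data** (JSW17 §7.4 shape at an additive prime, NO
engine): row as above; data `#Ш(E)_an = q` with `ord_p q ≤ 0` (LOWER(E) free,
`N10.missingLowerBoundAt_of_padicValRat_le_zero`) and the twist datum of
`missingUpperBoundAt_rankOne_cellGordTwo_of_twistShaAnUnit` (UPPER(E)); glued by x11b's `bsdp_of_halves`.
[cite: JetchevSkinnerWan2017, §7.4.1–7.4.3 (pp. 29–31)] [cite: McCallumLMS1991, §1 Theorem (Kolyvagin), p. 296]
[cite: EdixhovenManin1991, §1] [cite: Mazur1978, Cor. 4.1] [cite: AbbesUllmo1996, Thm. A]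
[cite: Miller2011LMS, §1 and Def. 1.1] -/
theorem bsdp_rankOne_cellGordTwo_of_shaAnUnit_of_twistShaAnUnit
    (hGZ : ∀ (N : ℕ) [NeZero N] (W : WeierstrassCurve ℚ) (K : Type) [Field K] [NumberField K],
      gross_zagier N W K)
    (hKo : ∀ (N : ℕ) [NeZero N] (W : WeierstrassCurve ℚ) (K : Type) [Field K] [NumberField K],
      kolyvagin N W K)
    (hB : ∀ (N : ℕ) [NeZero N] (W : WeierstrassCurve ℚ) (K : Type) [Field K] [NumberField K],
      Kolyvagin1990_padicValNat_card_sha_le N W K)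
    (hGZK : rank_eq_analyticRank_of_analyticRank_le_one) (hmod : hasEntireLFunction_rat)
    (hnf : exists_isNewformOf)
    (hMz : mazur_not_dvd_maninConstant_of_odd)
    (hAU : abbesUllmo_not_dvd_maninConstant_of_not_dvd_level)
    (hC2 : cesnavicius_not_two_dvd_maninConstant_of_two_dvd_level)
    (W : WeierstrassCurve ℚ) [W.IsElliptic] [W.IsGloballyMinimal] (p : ℕ) [Fact p.Prime]
    (K : Type) [Field K] [NumberField K]
    (Wd : WeierstrassCurve ℚ) [Wd.IsElliptic] [Wd.IsGloballyMinimal] (Cd : VariableChange ℚ)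
    (hr : W.analyticRank = 1) (hc2 : N10.CellGordTwo W p) (hp5 : 5 ≤ p)
    (hsurj : W.HasSurjectiveModNGaloisRep p) (htam : ¬ p ∣ W.tamagawaProduct)
    (hK : IsImaginaryQuadratic K) (hHN : SatisfiesHeegnerHypothesis (W.conductorNorm ℤ) K)
    (hLt : (W.quadraticTwist (NumberField.discr K : ℚ)).entireLFunction 1 ≠ 0)
    (hWd : Cd • W.quadraticTwist (NumberField.discr K : ℚ) = Wd)
    {q : ℚ} (hq : shaAn W = (q : ℂ)) (hv : padicValRat p q ≤ 0)
    {qd : ℚ} (hqd : shaAn Wd = (qd : ℂ)) (hvd : padicValRat p qd ≤ 0) : BSDp W p :=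
  bsdp_of_halves hGZK W p (le_of_eq hr) (N10.missingLowerBoundAt_of_padicValRat_le_zero W p hq hv)
    (missingUpperBoundAt_rankOne_cellGordTwo_of_twistShaAnUnit hGZ hKo hB hGZK hmod hnf hMz hAU hC2 W p K Wd Cd hr
      hc2 hp5 hsurj htam hK hHN hLt hWd hqd hvd)

/-- **`BSD(E,p)` per pair from PUBLISHED facts + the unit datum of `E` + crux 19357's conclusion at ONE Heegner
twist** (the content twists, `p ∣ #Ш(E^{d_K})_an`): row as above; `#Ш(E)_an = q` with `ord_p q ≤ 0`; a Heegner
field `K` of the conductor with `L(E^{d_K},1) ≠ 0`, a globally minimal `Wd = Cd • E^{d_K}` and the rank-ZERO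
LOWER half `Typed.MissingLowerBoundAt Wd p` there (crux `GordTwoRankZeroOffCaseOne`'s conclusion at `(Wd, p)`:
`Wd` is again additive potentially good at `p`, Part 1). UPPER(E) by Part 6 on Part 18a's Manin-good datum.
[cite: JetchevSkinnerWan2017, §7.4.1–7.4.3 (pp. 29–31)] [cite: McCallumLMS1991, §1 Theorem (Kolyvagin), p. 296]
[cite: EdixhovenManin1991, §1] [cite: Mazur1978, Cor. 4.1] [cite: Miller2011LMS, §1 and Def. 1.1] -/
theorem bsdp_rankOne_cellGordTwo_of_shaAnUnit_of_twistLower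
    (hGZ : ∀ (N : ℕ) [NeZero N] (W : WeierstrassCurve ℚ) (K : Type) [Field K] [NumberField K],
      gross_zagier N W K)
    (hKo : ∀ (N : ℕ) [NeZero N] (W : WeierstrassCurve ℚ) (K : Type) [Field K] [NumberField K],
      kolyvagin N W K)
    (hB : ∀ (N : ℕ) [NeZero N] (W : WeierstrassCurve ℚ) (K : Type) [Field K] [NumberField K],
      Kolyvagin1990_padicValNat_card_sha_le N W K)
    (hGZK : rank_eq_analyticRank_of_analyticRank_le_one) (hmod : hasEntireLFunction_rat)
    (hnf : exists_isNewformOf)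
    (hMz : mazur_not_dvd_maninConstant_of_odd)
    (hAU : abbesUllmo_not_dvd_maninConstant_of_not_dvd_level)
    (hC2 : cesnavicius_not_two_dvd_maninConstant_of_two_dvd_level)
    (W : WeierstrassCurve ℚ) [W.IsElliptic] [W.IsGloballyMinimal] (p : ℕ) [Fact p.Prime]
    (K : Type) [Field K] [NumberField K]
    (Wd : WeierstrassCurve ℚ) [Wd.IsElliptic] [Wd.IsGloballyMinimal] (Cd : VariableChange ℚ)
    (hr : W.analyticRank = 1) (hc2 : N10.CellGordTwo W p) (hp5 : 5 ≤ p)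
    (hsurj : W.HasSurjectiveModNGaloisRep p) (htam : ¬ p ∣ W.tamagawaProduct)
    (hK : IsImaginaryQuadratic K) (hHN : SatisfiesHeegnerHypothesis (W.conductorNorm ℤ) K)
    (hLt : (W.quadraticTwist (NumberField.discr K : ℚ)).entireLFunction 1 ≠ 0)
    (hWd : Cd • W.quadraticTwist (NumberField.discr K : ℚ) = Wd)
    {q : ℚ} (hq : shaAn W = (q : ℂ)) (hv : padicValRat p q ≤ 0)
    (htwL : Typed.MissingLowerBoundAt Wd p) : BSDp W p := by
  have hp : p.Prime := Fact.out
  have hlow : Typed.MissingLowerBoundAt W p := N10.missingLowerBoundAt_of_padicValRat_le_zero W p hq hv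
  have hp2 : p ≠ 2 := hc2.1
  have hadd : Addv W p := hc2.2.1
  haveI : NeZero (W.conductorNorm ℤ) := ⟨(W.conductorNorm_pos_holds).ne'⟩
  have hirr : Irr W p := hasIrreducibleModPGaloisRep_of_hasSurjectiveModNGaloisRep W p hsurj
  have hpN : p ∣ W.conductorNorm ℤ := (W.dvd_conductorNorm_iff_not_hasGoodReductionAtPrime p).mpr hadd.1
  have hμ : ¬ p ∣ Units.torsionOrder K := not_dvd_unitsTorsionOrder_of_heegner hK hHN hp hp2 hpN
  obtain ⟨Dt, H, ι, P, hP, hc⟩ := exists_maninDatum_of_cellGordTwo_of_irr hnf hMz hAU hC2 W p K hc2 hirr hK hHN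
  exact bsdp_of_halves hGZK W p (le_of_eq hr) hlow
    (missingUpperBoundAt_rankOne_additive_of_twistLower W p K Dt H ι P (hGZ _ W K) (hKo _ W K) (hB _ W K)
      hGZK hmod hr hp5 hsurj htam hK hHN hP hc hμ hLt Wd Cd hWd hadd.1 htwL)

end Summit.BirchSwinnertonDyer.BirchSwinnertonDyer.Theorems.AdditiveBranchIMCGordTwoRankOne.HeegnerKolyvagin

end
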